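import Mathlib
import Literature.MathematicalPhysics.QuantumFieldTheory.ConstructiveQFTWave0

/-!
# Stub `stub_freeClusterTail` of the line `planted-link-pinning` (crux `SusceptibilityToPoincare`)

Route `FradkinShenkerFlow` of `YangMills`, crux item `stmt-QuantumFields-9441`
(`Summit.QuantumFields.YangMills.Theses.FradkinShenkerFlow.SusceptibilityToPoincare`, FS ⇒ UP),
line `planted-link-pinning`, stub **S3e** `stub_freeClusterTail` of the registered skeleton
`Cruxes/SusceptibilityToPoincare/Lines/planted-link-pinning.lean`: pure finite combinatorics of
the link set `Edge 4 (2S+1)` of the torus (no gauge field, no measure).  Links are *pinned* (`∈ Λ`)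
or *free* (`∉ Λ`), the planted weight of `Λ` is `w_ε(Λ) = ε^{#E − #Λ} (1 − ε)^{#Λ}`; we exhibit a
labelling `c Λ` of the links, constant on free links sharing a plaquette, whose blocks
`block_Λ(ℓ) = {ℓ' free | c Λ ℓ' = c Λ ℓ}` satisfy `Σ_{Λ ∌ ℓ} w_ε(Λ) B^{#block_Λ(ℓ)} ≤ 2B` uniformly
in the volume once `ε ≤ 1/(4·324²·B)` (subcritical percolation of the free links).

**Proof.** Generic percolation part: a finite type `α`, a symmetric neighbourhood map `N` of
degree `≤ Δ`, the free clusters `K Λ a` (points reachable from `a` through free neighbours).  If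
`ℓ` is free with `#K Λ ℓ ≥ k+1` there is an `N`-chain of length `2k+1` from `ℓ` through free
points with `k+1` distinct entries (`witness`: splice a boundary step `u → u' → u` into a shorter
witness); such chains number `≤ Δ^{2k}` (`exists_walks`), each being entirely free with planted
probability `ε^{#entries}` (`bernoulli_marginal`); so for a labelling `c` with level sets inside
free clusters `Σ_{Λ∌ℓ} w_ε(Λ) B^{#block} ≤ Σ_{k<#E} B^{k+1} Δ^{2k} ε^{k+1} ≤ B Σ_k 4^{-k} ≤ 2B` once
`BΔ²ε ≤ 1/4` (`tail_bound`).  On the torus `N` is the *box* neighbourhood (each base-point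
coordinate shifted by `0, ±1`): two links of a plaquette are box-neighbours (`adj_plaquette`),
`Δ = 3⁴·4 = 324` (`card_nbhd_le`), and the label is a numerical code of the free box cluster.
-/

noncomputable section

open MeasureTheory ProbabilityTheory
open Literature.MathematicalPhysics.QuantumFieldTheory

namespace Summit.QuantumFields.YangMills.Theorems.SusceptibilityToPoincare

namespace FreeClusterTail

open Finset

section Generic

variable {α : Type*} {N : α → Finset α} {K : Finset α → α → Finset α}

/-- The free-cluster relation is symmetric. [folklore] -/
theorem cls_symm (hN : ∀ a b, b ∈ N a → a ∈ N b)
    (hK : ∀ Λ a b, b ∈ K Λ a ↔ Relation.ReflTransGen (fun x y => x ∉ Λ ∧ y ∉ Λ ∧ y ∈ N x) a b)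
    {Λ : Finset α} {a b : α} (h : b ∈ K Λ a) : a ∈ K Λ b := by
  rw [hK] at h ⊢
  induction h with
  | refl => exact Relation.ReflTransGen.refl
  | tail _ hbc ih => exact Relation.ReflTransGen.head ⟨hbc.2.1, hbc.1, hN _ _ hbc.2.2⟩ ih

/-- Points in the same free cluster have equal free clusters. [folklore] -/
theorem cls_eq_of_mem (hN : ∀ a b, b ∈ N a → a ∈ N b)
    (hK : ∀ Λ a b, b ∈ K Λ a ↔ Relation.ReflTransGen (fun x y => x ∉ Λ ∧ y ∉ Λ ∧ y ∈ N x) a b)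
    {Λ : Finset α} {a b : α} (h : b ∈ K Λ a) : K Λ a = K Λ b := by
  ext x
  rw [hK, hK]
  exact ⟨fun hx => Relation.ReflTransGen.trans ((hK _ _ _).1 (cls_symm hN hK h)) hx,
    fun hx => Relation.ReflTransGen.trans ((hK _ _ _).1 h) hx⟩

variable [DecidableEq α]

/-- Boundary step: a free-cluster chain from a point of `V` either ends in `V` or exhibits a point
`u ∈ V` with a free neighbour `u' ∉ V`. [folklore] -/
theorem boundary
    (hK : ∀ Λ a b, b ∈ K Λ a ↔ Relation.ReflTransGen (fun x y => x ∉ Λ ∧ y ∉ Λ ∧ y ∈ N x) a b)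
    {Λ V : Finset α} {a b : α} (ha : a ∈ V) (h : b ∈ K Λ a) :
    b ∈ V ∨ ∃ u ∈ V, ∃ u', u' ∉ V ∧ u' ∉ Λ ∧ u' ∈ N u := by
  rw [hK] at h
  induction h with
  | refl => exact Or.inl ha
  | @tail b c _ hbc ih =>
    rcases ih with hb | hb
    · by_cases hc : c ∈ V
      · exact Or.inl hc
      · exact Or.inr ⟨b, hb, c, hc, hbc.2.1, hbc.2.2⟩
    · exact Or.inr hb

/-- **Witness lemma.** If `ℓ` is free and its free cluster has at least `k + 1` points, there is a
list of length `2k + 1` starting at `ℓ`, each entry a neighbour of the previous one, all entries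
free, with exactly `k + 1` distinct entries. [folklore] -/
theorem witness (hN : ∀ a b, b ∈ N a → a ∈ N b)
    (hK : ∀ Λ a b, b ∈ K Λ a ↔ Relation.ReflTransGen (fun x y => x ∉ Λ ∧ y ∉ Λ ∧ y ∈ N x) a b)
    {Λ : Finset α} {ℓ : α} (hℓ : ℓ ∉ Λ) :
    ∀ k : ℕ, k + 1 ≤ (K Λ ℓ).card → ∃ w : List α, w.head? = some ℓ ∧
      w.IsChain (fun x y => y ∈ N x) ∧ w.length = 2 * k + 1 ∧ (∀ x ∈ w, x ∉ Λ) ∧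
      w.toFinset.card = k + 1 := by
  intro k
  induction k with
  | zero => exact fun _ => ⟨[ℓ], rfl, .singleton ℓ, rfl, by simpa using hℓ, by simp⟩
  | succ k ih =>
    intro hk
    obtain ⟨w, hw, hc, hlen, hfree, hcard⟩ := ih (by omega)
    obtain ⟨x, hx, hxV⟩ := Finset.not_subset.1 fun hsub : K Λ ℓ ⊆ w.toFinset => by
      have := Finset.card_le_card hsub
      omega
    rcases boundary hK (List.mem_toFinset.2 (List.mem_of_mem_head? hw)) hx with
      h | ⟨u, huV, u', hu'V, hu'Λ, huu'⟩
    · exact absurd h hxV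
    obtain ⟨p, q, rfl⟩ := List.append_of_mem (List.mem_toFinset.1 huV)
    refine ⟨p ++ u :: u' :: u :: q, by cases p <;> exact hw, ?_, ?_, ?_, ?_⟩
    · obtain ⟨hp, huq, hj⟩ := List.isChain_append.1 hc
      exact List.isChain_append.2 ⟨hp, .cons_cons huu' (.cons_cons (hN _ _ huu') huq), hj⟩
    · simp only [List.length_append, List.length_cons] at hlen ⊢
      omega
    · intro x hx
      by_cases hxu' : x = u'
      · exact hxu' ▸ hu'Λ
      · apply hfree
        simp only [List.mem_append, List.mem_cons] at hx ⊢
        tauto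
    · have hins : (p ++ u :: u' :: u :: q).toFinset = insert u' (p ++ u :: q).toFinset := by
        ext x
        simp only [List.mem_toFinset, Finset.mem_insert, List.mem_append, List.mem_cons]
        tauto
      rw [hins, Finset.card_insert_of_notMem hu'V, hcard]

/-- Counting chains: the lists of length `n + 1` from `a`, each entry a neighbour of the previous
one, lie in a finset of at most `Δ^n` lists when all neighbourhoods have `≤ Δ` points. [folklore] -/
theorem exists_walks {Δ : ℕ} (hΔ : ∀ a, (N a).card ≤ Δ) : ∀ (n : ℕ) (a : α),
    ∃ T : Finset (List α), T.card ≤ Δ ^ n ∧ ∀ t : List α,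
      (a :: t).IsChain (fun x y => y ∈ N x) → (a :: t).length = n + 1 → a :: t ∈ T := by
  intro n
  induction n with
  | zero =>
    refine fun a => ⟨{[a]}, by simp, fun t _ hlen => ?_⟩
    obtain rfl : t = [] := by simpa using hlen
    simp
  | succ n ih =>
    intro a
    choose T hT using ih
    refine ⟨(N a).biUnion fun b => (T b).image (List.cons a), ?_, fun t hc hlen => ?_⟩
    · rw [pow_succ]
      refine Finset.card_biUnion_le.trans ?_
      refine (Finset.sum_le_sum fun b _ => Finset.card_image_le.trans (hT b).1).trans ?_
      rw [Finset.sum_const, smul_eq_mul, mul_comm]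
      exact Nat.mul_le_mul_left _ (hΔ a)
    · cases t with
      | nil => simp at hlen
      | cons b t =>
        rw [List.isChain_cons_cons] at hc
        simp only [Finset.mem_biUnion, Finset.mem_image]
        exact ⟨b, hc.1, b :: t, (hT b).2 t hc.2 (by simpa using hlen), rfl⟩

variable [Fintype α]

/-- Union bound: the indicator of "the free cluster of the free point `ℓ` has at least `k + 1`
points" is dominated by the number of witnesses all of whose entries are free. [folklore] -/
theorem indicator_le_sum (hN : ∀ a b, b ∈ N a → a ∈ N b)
    (hK : ∀ Λ a b, b ∈ K Λ a ↔ Relation.ReflTransGen (fun x y => x ∉ Λ ∧ y ∉ Λ ∧ y ∈ N x) a b)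
    {Λ : Finset α} {ℓ : α} (hℓ : ℓ ∉ Λ) (k : ℕ) {T : Finset (List α)}
    (hT : ∀ t : List α, (ℓ :: t).IsChain (fun x y => y ∈ N x) → (ℓ :: t).length = 2 * k + 1 →
      ℓ :: t ∈ T) :
    (if k + 1 ≤ (K Λ ℓ).card then (1 : ℝ) else 0) ≤
      ∑ v ∈ T.filter (fun v => k + 1 ≤ v.toFinset.card),
        (if ∀ x ∈ v, x ∉ Λ then (1 : ℝ) else 0) := by
  split_ifs with hk
  · obtain ⟨w, hw, hc, hlen, hfree, hcard⟩ := witness hN hK hℓ k hk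
    obtain ⟨t, rfl⟩ : ∃ t, w = ℓ :: t := by
      cases w with
      | nil => cases hw
      | cons a t => exact ⟨t, by rw [(Option.some.inj hw : a = ℓ)]⟩
    have hmem : ℓ :: t ∈ T.filter (fun v => k + 1 ≤ v.toFinset.card) :=
      Finset.mem_filter.2 ⟨hT t hc hlen, hcard.ge⟩
    exact le_trans (if_pos hfree).symm.le (Finset.single_le_sum
      (f := fun v => if ∀ x ∈ v, x ∉ Λ then (1 : ℝ) else 0) (fun v _ => by positivity) hmem)
  · exact Finset.sum_nonneg fun v _ => by positivity

/-- Bernoulli marginal: the planted weight of the event "all points of `V` are free" is `ε^{#V}`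
(binomial theorem on `Vᶜ`). [folklore] -/
theorem bernoulli_marginal (ε : ℝ) (V : Finset α) :
    ∑ Λ ∈ (univ : Finset (Finset α)).filter (fun Λ => ∀ v ∈ V, v ∉ Λ),
      ε ^ (Fintype.card α - Λ.card) * (1 - ε) ^ Λ.card = ε ^ V.card := by
  have hset : (univ : Finset (Finset α)).filter (fun Λ => ∀ v ∈ V, v ∉ Λ) = Vᶜ.powerset := by
    ext Λ
    simp only [Finset.mem_filter, Finset.mem_univ, true_and, Finset.mem_powerset,
      Finset.subset_iff, Finset.mem_compl]
    exact ⟨fun h x hxΛ hxV => h x hxV hxΛ, fun h v hvV hvΛ => h hvΛ hvV⟩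
  have hE : Fintype.card α = V.card + Vᶜ.card := by
    rw [Finset.card_compl, Nat.add_sub_cancel' (Finset.card_le_univ V)]
  rw [hset]
  calc ∑ Λ ∈ Vᶜ.powerset, ε ^ (Fintype.card α - Λ.card) * (1 - ε) ^ Λ.card
      = ∑ Λ ∈ Vᶜ.powerset, ε ^ V.card * ((1 - ε) ^ Λ.card * ε ^ (Vᶜ.card - Λ.card)) := by
        refine Finset.sum_congr rfl fun Λ hΛ => ?_
        rw [hE, Nat.add_sub_assoc (Finset.card_le_card (Finset.mem_powerset.1 hΛ)), pow_add]
        ring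
    _ = ε ^ V.card := by
        rw [← Finset.mul_sum, Finset.sum_pow_mul_eq_add_pow, sub_add_cancel, one_pow, mul_one]

/-- Planted weight of "all entries of the list `v` are free": `ε^{# distinct entries}`. [folklore] -/
theorem list_marginal (ε : ℝ) (v : List α) :
    ∑ Λ : Finset α, ε ^ (Fintype.card α - Λ.card) * (1 - ε) ^ Λ.card *
      (if ∀ x ∈ v, x ∉ Λ then (1 : ℝ) else 0) = ε ^ v.toFinset.card := by
  rw [← bernoulli_marginal ε v.toFinset, Finset.sum_filter]
  refine Finset.sum_congr rfl fun Λ _ => ?_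
  by_cases h : ∀ x ∈ v, x ∉ Λ
  · rw [if_pos h, if_pos (fun x hx => h x (List.mem_toFinset.1 hx)), mul_one]
  · rw [if_neg h, if_neg (fun h' => h fun x hx => h' x (List.mem_toFinset.2 hx)), mul_zero]

/-- **Level bound.** The planted weight of "`ℓ` is free with a free cluster of at least `k + 1`
points" is at most `Δ^{2k} ε^{k+1}` (union bound over witnesses, Bernoulli marginals).
[folklore] -/
theorem level_bound (hN : ∀ a b, b ∈ N a → a ∈ N b)
    (hK : ∀ Λ a b, b ∈ K Λ a ↔ Relation.ReflTransGen (fun x y => x ∉ Λ ∧ y ∉ Λ ∧ y ∈ N x) a b)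
    {Δ : ℕ} (hΔ : ∀ a, (N a).card ≤ Δ) {ε : ℝ} (hε0 : 0 ≤ ε) (hε1 : ε ≤ 1) (ℓ : α) (k : ℕ) :
    ∑ Λ ∈ (univ : Finset (Finset α)).filter (fun Λ => ℓ ∉ Λ),
      ε ^ (Fintype.card α - Λ.card) * (1 - ε) ^ Λ.card *
        (if k + 1 ≤ (K Λ ℓ).card then (1 : ℝ) else 0) ≤ (Δ : ℝ) ^ (2 * k) * ε ^ (k + 1) := by
  obtain ⟨T, hTc, hT⟩ := exists_walks hΔ (2 * k) ℓ
  obtain ⟨W, hW⟩ : ∃ W : Finset (List α), T.filter (fun v => k + 1 ≤ v.toFinset.card) = W :=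
    ⟨_, rfl⟩
  have hWk : ∀ v ∈ W, k + 1 ≤ v.toFinset.card := fun v hv => by
    rw [← hW] at hv
    exact (Finset.mem_filter.1 hv).2
  have hWc : (W.card : ℝ) ≤ (Δ : ℝ) ^ (2 * k) := by
    have h : W.card ≤ Δ ^ (2 * k) := hW ▸ (Finset.card_filter_le _ _).trans hTc
    exact_mod_cast h
  have hw0 : ∀ Λ : Finset α, 0 ≤ ε ^ (Fintype.card α - Λ.card) * (1 - ε) ^ Λ.card :=
    fun Λ => mul_nonneg (pow_nonneg hε0 _) (pow_nonneg (sub_nonneg.2 hε1) _)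
  calc _ ≤ ∑ Λ ∈ (univ : Finset (Finset α)).filter (fun Λ => ℓ ∉ Λ),
          ε ^ (Fintype.card α - Λ.card) * (1 - ε) ^ Λ.card *
            ∑ v ∈ W, (if ∀ x ∈ v, x ∉ Λ then (1 : ℝ) else 0) :=
        Finset.sum_le_sum fun Λ hΛ => mul_le_mul_of_nonneg_left
          (hW ▸ indicator_le_sum hN hK (Finset.mem_filter.1 hΛ).2 k (hT ·)) (hw0 Λ)
    _ ≤ ∑ Λ : Finset α, ε ^ (Fintype.card α - Λ.card) * (1 - ε) ^ Λ.card *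
          ∑ v ∈ W, (if ∀ x ∈ v, x ∉ Λ then (1 : ℝ) else 0) :=
        Finset.sum_le_sum_of_subset_of_nonneg (Finset.filter_subset _ _) fun Λ _ _ =>
          mul_nonneg (hw0 Λ) (Finset.sum_nonneg fun v _ => by positivity)
    _ = ∑ v ∈ W, ∑ Λ : Finset α, ε ^ (Fintype.card α - Λ.card) * (1 - ε) ^ Λ.card *
          (if ∀ x ∈ v, x ∉ Λ then (1 : ℝ) else 0) := by
        simp only [Finset.mul_sum]
        exact Finset.sum_comm
    _ = ∑ v ∈ W, ε ^ v.toFinset.card := Finset.sum_congr rfl fun v _ => list_marginal ε v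
    _ ≤ ∑ v ∈ W, ε ^ (k + 1) :=
        Finset.sum_le_sum fun v hv => pow_le_pow_of_le_one hε0 hε1 (hWk v hv)
    _ = W.card * ε ^ (k + 1) := by rw [Finset.sum_const, nsmul_eq_mul]
    _ ≤ (Δ : ℝ) ^ (2 * k) * ε ^ (k + 1) := mul_le_mul_of_nonneg_right hWc (pow_nonneg hε0 _)

/-- **Tail bound.** For `B ≥ 1`, `0 ≤ ε ≤ 1` with `B Δ² ε ≤ 1/4` and any labelling `c` whose level
sets lie inside free clusters, the planted exponential moment of the label block of any point is
at most `2B`. [folklore] -/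
theorem tail_bound (hN : ∀ a b, b ∈ N a → a ∈ N b)
    (hK : ∀ Λ a b, b ∈ K Λ a ↔ Relation.ReflTransGen (fun x y => x ∉ Λ ∧ y ∉ Λ ∧ y ∈ N x) a b)
    {Δ : ℕ} (hΔ : ∀ a, (N a).card ≤ Δ) {B ε : ℝ} (hB : 1 ≤ B) (hε0 : 0 ≤ ε) (hε1 : ε ≤ 1)
    (hsmall : B * (Δ : ℝ) ^ 2 * ε ≤ 1 / 4) (c : Finset α → α → ℕ)
    (hc : ∀ (Λ : Finset α) (a b : α), c Λ b = c Λ a → b ∈ K Λ a) (ℓ : α) :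
    ∑ Λ ∈ (Finset.univ : Finset (Finset α)).filter (fun Λ => ℓ ∉ Λ),
      ε ^ (Fintype.card α - Λ.card) * (1 - ε) ^ Λ.card *
        B ^ (Finset.univ.filter (fun ℓ' : α => ℓ' ∉ Λ ∧ c Λ ℓ' = c Λ ℓ)).card ≤ 2 * B := by
  have hB0 : (0 : ℝ) ≤ B := zero_le_one.trans hB
  set M := Fintype.card α with hM
  have hw0 : ∀ Λ : Finset α, 0 ≤ ε ^ (M - Λ.card) * (1 - ε) ^ Λ.card :=
    fun Λ => mul_nonneg (pow_nonneg hε0 _) (pow_nonneg (sub_nonneg.2 hε1) _)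
  have h1 : ∀ Λ : Finset α, B ^ (univ.filter (fun ℓ' : α => ℓ' ∉ Λ ∧ c Λ ℓ' = c Λ ℓ)).card ≤
      ∑ k ∈ range M, B ^ (k + 1) * (if k + 1 ≤ (K Λ ℓ).card then (1 : ℝ) else 0) := by
    intro Λ
    have hm1 : 1 ≤ (K Λ ℓ).card := Finset.card_pos.2 ⟨ℓ, (hK _ _ _).2 Relation.ReflTransGen.refl⟩
    have hmM : (K Λ ℓ).card ≤ M := Finset.card_le_univ _
    calc B ^ (univ.filter (fun ℓ' : α => ℓ' ∉ Λ ∧ c Λ ℓ' = c Λ ℓ)).card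
        ≤ B ^ (K Λ ℓ).card := pow_le_pow_right₀ hB
          (Finset.card_le_card fun x hx => hc Λ ℓ x (Finset.mem_filter.1 hx).2.2)
      _ = B ^ ((K Λ ℓ).card - 1 + 1) *
            (if (K Λ ℓ).card - 1 + 1 ≤ (K Λ ℓ).card then (1 : ℝ) else 0) := by
          rw [Nat.sub_add_cancel hm1, if_pos le_rfl, mul_one]
      _ ≤ ∑ k ∈ range M, B ^ (k + 1) * (if k + 1 ≤ (K Λ ℓ).card then (1 : ℝ) else 0) :=
          Finset.single_le_sum (f := fun k => B ^ (k + 1) *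
            (if k + 1 ≤ (K Λ ℓ).card then (1 : ℝ) else 0))
            (fun k _ => mul_nonneg (pow_nonneg hB0 _) (by positivity)) (mem_range.2 (by omega))
  calc _ ≤ ∑ Λ ∈ (Finset.univ : Finset (Finset α)).filter (fun Λ => ℓ ∉ Λ),
          ε ^ (M - Λ.card) * (1 - ε) ^ Λ.card *
            ∑ k ∈ range M, B ^ (k + 1) * (if k + 1 ≤ (K Λ ℓ).card then (1 : ℝ) else 0) :=
        Finset.sum_le_sum fun Λ _ => mul_le_mul_of_nonneg_left (h1 Λ) (hw0 Λ)
    _ = ∑ k ∈ range M, B ^ (k + 1) *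
          ∑ Λ ∈ (Finset.univ : Finset (Finset α)).filter (fun Λ => ℓ ∉ Λ),
            ε ^ (M - Λ.card) * (1 - ε) ^ Λ.card *
              (if k + 1 ≤ (K Λ ℓ).card then (1 : ℝ) else 0) := by
        simp only [Finset.mul_sum]
        rw [Finset.sum_comm]
        exact Finset.sum_congr rfl fun k _ => Finset.sum_congr rfl fun Λ _ => by ring
    _ ≤ ∑ k ∈ range M, B ^ (k + 1) * ((Δ : ℝ) ^ (2 * k) * ε ^ (k + 1)) :=
        Finset.sum_le_sum fun k _ =>
          mul_le_mul_of_nonneg_left (level_bound hN hK hΔ hε0 hε1 ℓ k) (pow_nonneg hB0 _)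
    _ = ∑ k ∈ range M, (B * ε) * (B * (Δ : ℝ) ^ 2 * ε) ^ k :=
        Finset.sum_congr rfl fun k _ => by ring
    _ ≤ ∑ k ∈ range M, B * (1 / 4 : ℝ) ^ k := Finset.sum_le_sum fun k _ => mul_le_mul
        (mul_le_of_le_one_right hB0 hε1) (pow_le_pow_left₀ (by positivity) hsmall k)
        (by positivity) hB0
    _ ≤ B * ((1 / 4 : ℝ) ^ 0 / (1 - 1 / 4)) := by
        rw [← Finset.mul_sum, Finset.range_eq_Ico]
        exact mul_le_mul_of_nonneg_left (geom_sum_Ico_le_of_lt_one (by norm_num) (by norm_num)) hB0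
    _ ≤ 2 * B := by
        norm_num
        linarith

end Generic

section Torus

variable {d L : ℕ}

/-- Box adjacency (each base-point coordinate shifted by `0, +1, −1`) is symmetric. [folklore] -/
theorem adj_symm {a b : Edge d L} (h : ∀ ν, b.1 ν = a.1 ν ∨ b.1 ν = a.1 ν + 1 ∨ b.1 ν = a.1 ν - 1) :
    ∀ ν, a.1 ν = b.1 ν ∨ a.1 ν = b.1 ν + 1 ∨ a.1 ν = b.1 ν - 1 := fun ν => by
  rcases h ν with h | h | h
  · exact Or.inl h.symm
  · exact Or.inr (Or.inr (by rw [h, add_sub_cancel_right]))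
  · exact Or.inr (Or.inl (by rw [h, sub_add_cancel]))

/-- Two links of one plaquette `{(y,i), (y+eᵢ,j), (y+eⱼ,i), (y,j)}` are box-adjacent. [folklore] -/
theorem adj_plaquette (y : Site d L) (i j : Fin d) {e e' : Edge d L}
    (he : e ∈ ({(y, i), (y.shift i, j), (y.shift j, i), (y, j)} : Finset (Edge d L)))
    (he' : e' ∈ ({(y, i), (y.shift i, j), (y.shift j, i), (y, j)} : Finset (Edge d L))) :
    ∀ ν, e'.1 ν = e.1 ν ∨ e'.1 ν = e.1 ν + 1 ∨ e'.1 ν = e.1 ν - 1 := by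
  simp only [Finset.mem_insert, Finset.mem_singleton] at he he'
  rcases he with rfl | rfl | rfl | rfl <;> rcases he' with rfl | rfl | rfl | rfl <;> intro ν <;>
    (try simp only [Site.shift, Pi.add_apply, Pi.single_apply]) <;> (try split_ifs) <;> simp

variable [NeZero L]

/-- Every link has at most `3^d · d` box-neighbours. [folklore] -/
theorem card_nbhd_le (a : Edge d L) : (univ.filter fun b : Edge d L =>
      ∀ ν, b.1 ν = a.1 ν ∨ b.1 ν = a.1 ν + 1 ∨ b.1 ν = a.1 ν - 1).card ≤ 3 ^ d * d := by
  calc _ ≤ ((Fintype.piFinset fun ν => ({a.1 ν, a.1 ν + 1, a.1 ν - 1} : Finset (ZMod L))) ×ˢ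
          (univ : Finset (Fin d))).card := by
        refine Finset.card_le_card fun b hb => ?_
        simp only [Finset.mem_filter, Finset.mem_univ, true_and] at hb
        simpa only [Finset.mem_product, Fintype.mem_piFinset, Finset.mem_insert,
          Finset.mem_singleton, Finset.mem_univ, and_true] using hb
    _ ≤ 3 ^ d * d := by
        rw [Finset.card_product, Fintype.card_piFinset, Finset.card_univ, Fintype.card_fin]
        refine Nat.mul_le_mul_right _ ?_
        simpa using Finset.prod_le_pow_card (univ : Finset (Fin d)) _ 3
          fun ν _ => Finset.card_le_three

end Torus

end FreeClusterTail

open FreeClusterTail in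
/-- **S3e · planted free clusters have an exponential moment, uniformly in the volume.**  For every
`B ≥ 1` there is `ε₀ ∈ (0,1)` and for every `0 < ε ≤ ε₀` a constant `C ≥ 0` such that on every
torus `(ℤ/(2S+1))⁴` there is a labelling `c Λ` of the links (for each pinned set `Λ`), constant on
free links sharing a plaquette, with `Σ_{Λ ∌ ℓ} ε^{#Λᶜ}(1−ε)^{#Λ} B^{#block_Λ(ℓ)} ≤ C` for every
link `ℓ`, where `block_Λ(ℓ) = {ℓ' ∉ Λ | c Λ ℓ' = c Λ ℓ}`.  The labelling is a numerical code of the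
free box cluster, `ε₀ = 1/(4·324²·B)` and `C = 2B`. [folklore] -/
theorem stub_freeClusterTail :
    ∀ (B : ℝ), 1 ≤ B → ∃ ε₀ : ℝ, 0 < ε₀ ∧ ε₀ < 1 ∧ ∀ ε : ℝ, 0 < ε → ε ≤ ε₀ → ∃ C : ℝ, 0 ≤ C ∧
      ∀ (S : ℕ), ∃ c : Finset (Edge 4 (2 * S + 1)) → Edge 4 (2 * S + 1) → ℕ,
        (∀ (Λ : Finset (Edge 4 (2 * S + 1))) (y : Site 4 (2 * S + 1)) (i j : Fin 4), i < j →
          ∀ e ∈ ({(y, i), (y.shift i, j), (y.shift j, i), (y, j)} : Finset (Edge 4 (2 * S + 1))),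
          ∀ e' ∈ ({(y, i), (y.shift i, j), (y.shift j, i), (y, j)} : Finset (Edge 4 (2 * S + 1))),
          e ∉ Λ → e' ∉ Λ → c Λ e = c Λ e') ∧
        ∀ ℓ : Edge 4 (2 * S + 1),
          ∑ Λ ∈ (Finset.univ : Finset (Finset (Edge 4 (2 * S + 1)))).filter (fun Λ => ℓ ∉ Λ),
            ε ^ (Fintype.card (Edge 4 (2 * S + 1)) - Λ.card) * (1 - ε) ^ Λ.card *
              B ^ (Finset.univ.filter (fun ℓ' : Edge 4 (2 * S + 1) => ℓ' ∉ Λ ∧ c Λ ℓ' = c Λ ℓ)).card ≤ C := by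
  intro B hB
  have hBpos : (0 : ℝ) < B := zero_lt_one.trans_le hB
  refine ⟨1 / (4 * 324 ^ 2 * B), by positivity, ?_, ?_⟩
  · rw [div_lt_one (by positivity)]
    nlinarith
  intro ε hε hεle
  have hε1 : ε ≤ 1 := hεle.trans (by rw [div_le_one (by positivity)]; nlinarith)
  have hsmall : B * ((3 ^ 4 * 4 : ℕ) : ℝ) ^ 2 * ε ≤ 1 / 4 := by
    rw [show ((3 ^ 4 * 4 : ℕ) : ℝ) = 324 by norm_num]
    calc B * 324 ^ 2 * ε ≤ B * 324 ^ 2 * (1 / (4 * 324 ^ 2 * B)) :=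
          mul_le_mul_of_nonneg_left hεle (by positivity)
      _ = 1 / 4 := by
          field_simp
  refine ⟨2 * B, by positivity, fun S => ?_⟩
  let N : Edge 4 (2 * S + 1) → Finset (Edge 4 (2 * S + 1)) := fun a => Finset.univ.filter
    fun b : Edge 4 (2 * S + 1) => ∀ ν, b.1 ν = a.1 ν ∨ b.1 ν = a.1 ν + 1 ∨ b.1 ν = a.1 ν - 1
  let K : Finset (Edge 4 (2 * S + 1)) → Edge 4 (2 * S + 1) → Finset (Edge 4 (2 * S + 1)) :=
    fun Λ a => @Finset.filter _ (Relation.ReflTransGen (fun x y => x ∉ Λ ∧ y ∉ Λ ∧ y ∈ N x) a)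
      (Classical.decPred _) Finset.univ
  have hN : ∀ a b, b ∈ N a → a ∈ N b := fun a b h => by
    simp only [N, Finset.mem_filter, Finset.mem_univ, true_and] at h ⊢
    exact adj_symm h
  have hK : ∀ Λ a b, b ∈ K Λ a ↔
      Relation.ReflTransGen (fun x y => x ∉ Λ ∧ y ∉ Λ ∧ y ∈ N x) a b := fun Λ a b => by
    simp only [K, Finset.mem_filter, Finset.mem_univ, true_and]
  have hc : ∀ (Λ : Finset (Edge 4 (2 * S + 1))) (a b : Edge 4 (2 * S + 1)),
      (Fintype.equivFin (Finset (Edge 4 (2 * S + 1))) (K Λ b) : ℕ) =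
        Fintype.equivFin (Finset (Edge 4 (2 * S + 1))) (K Λ a) → b ∈ K Λ a := fun Λ a b h => by
    rw [← (Fintype.equivFin _).injective (Fin.ext h)]
    exact (hK _ _ _).2 Relation.ReflTransGen.refl
  refine ⟨fun Λ a => Fintype.equivFin (Finset (Edge 4 (2 * S + 1))) (K Λ a), ?_,
    fun ℓ => tail_bound hN hK (fun a => card_nbhd_le a) hB hε.le hε1 hsmall _ hc ℓ⟩
  intro Λ y i j _ e he e' he' heΛ he'Λ
  exact congrArg (fun s : Finset (Edge 4 (2 * S + 1)) => (Fintype.equivFin _ s : ℕ))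
    (cls_eq_of_mem hN hK ((hK _ _ _).2 (Relation.ReflTransGen.single ⟨heΛ, he'Λ, by
      simpa only [N, Finset.mem_filter, Finset.mem_univ, true_and] using adj_plaquette y i j he he'⟩)))

end Summit.QuantumFields.YangMills.Theorems.SusceptibilityToPoincare

end
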